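import Summits.NavierStokesRegularity.NavierStokesRegularity.Theorems.LevelSetModerationHighSpeedPressureWorkSliceDecay
import Literature.Analysis.FluidPDE.NormalisedPressureDuality
import Literature.Analysis.FluidPDE.NormalisedPressureDischarge
import Literature.Analysis.FluidPDE.RapidDecayLemmas

/-!
# Route LevelSetModeration — `HighSpeedPressureWork`: uniform bounds on closed slabs

Support file for item stmt-NavierStokesRegularity-18149 (towards the registered stub
`stub_sliceRegularity` of line `Sketch`, clause (ii): `u` and the GIVEN pressure `p` are bounded on
every closed slab `[0, t] × ℝ³`, `t < T`). For `ν > 0` and a classical solution `(u, p)` of the unforced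
Navier–Stokes system on `ℝ³ × [0, T)` that is Leray–Hopf on `[0, T]` from a rapidly decaying datum:

* `levelSetModeration_slab_velocity_bound` — `‖u‖ ≤ M` on `[0, T₁] × ℝ³`, `T₁ < T` (Tao's `H^k` bounds,
  `levelSetModeration_hasBoundedSobolevNormsOn_slab`, and the Sobolev imbedding
  `linfty_bound_of_hasBoundedSobolevNormsOn_holds`);
* `levelSetModeration_slab_normalisedPressure_bound` — `|p̃[u(τ)](x)| ≤ P` on `[0, T₁] × ℝ³`
  (`abs_normalisedPressure_le`: `|p̃| ≤ M²/3 + 8 M L + ‖u‖₂²/(2π)` with the slab bounds `‖u‖ ≤ M`,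
  `‖Du‖ ≤ L` and the energy inequality);
* `levelSetModeration_le_of_ae_le_of_continuousWithinAt` — an a.e. bound on `[0, T']` for a function
  continuous within `[0, T)` holds everywhere on `[0, T']` (intervals have positive measure);
* `levelSetModeration_slab_pressure_bound` — `|p| ≤ B` on `[0, t] × ℝ³`, `t < T`, for the GIVEN pressure:
  `p = p̃ + C(τ)` for a.e. `τ` with `C` bounded (`tao_pressure_normalisation_holds`), upgraded to every
  `τ` by continuity of `τ ↦ p τ x`.
-/

noncomputable section

-- single-conjunct summit: `Summit.<Summit>.<Problem>` repeats the name by the D-0017 layout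
set_option linter.dupNamespace false

namespace Summit.NavierStokesRegularity.NavierStokesRegularity.Theorems

open MeasureTheory Set Filter Topology Function Metric
open scoped ENNReal
open Literature.Analysis.FluidPDE

section Slab

variable {ν T : ℝ} {u : ℝ → EuclideanSpace ℝ (Fin 3) → EuclideanSpace ℝ (Fin 3)}
  {p : ℝ → EuclideanSpace ℝ (Fin 3) → ℝ}

/-- **The velocity is bounded on closed slabs** `[0, T₁] × ℝ³`, `T₁ < T` (Tao 2013, Cor. 11.1 with the
Sobolev imbedding `H² ⊂ C_B`). [cite: Tao2011, Cor. 11.1] -/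
theorem levelSetModeration_slab_velocity_bound (hν : 0 < ν)
    (hcl : IsClassicalNSSolutionOn (Ico 0 T) ν 0 u p) (hLH : IsLerayHopfOn T ν 0 (u 0) u)
    (hdec : HasRapidSpatialDecay (u 0)) {T₁ : ℝ} (hT₁ : T₁ ∈ Ioo 0 T) :
    ∃ M : ℝ, 0 ≤ M ∧ ∀ τ ∈ Icc 0 T₁, ∀ x, ‖u τ x‖ ≤ M := by
  have hH := levelSetModeration_hasBoundedSobolevNormsOn_slab hν hcl hLH hdec hT₁
  have hC2 : ∀ τ ∈ Icc 0 T₁, ContDiff ℝ 2 (u τ) := fun τ hτ =>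
    (hcl.contDiff_velocity ⟨hτ.1, hτ.2.trans_lt hT₁.2⟩).of_le (by norm_cast)
  obtain ⟨M, hM⟩ := linfty_bound_of_hasBoundedSobolevNormsOn_holds hC2 hH
  refine ⟨max M 0, le_max_right _ _, fun τ hτ x => (hM τ hτ x).trans (le_max_left _ _)⟩

/-- **The energy of every slice is bounded by the initial energy**: `∫ ‖u τ‖² ≤ 2 E(u 0)` for
`τ ∈ [0, T]` (Leray–Hopf energy inequality with `f = 0`, `ν ≥ 0`). [folklore] -/
theorem levelSetModeration_integral_norm_sq_le (hν : 0 ≤ ν) (hLH : IsLerayHopfOn T ν 0 (u 0) u)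
    {τ : ℝ} (hτ : τ ∈ Icc 0 T) :
    (∫ x, ‖u τ x‖ ^ 2) ≤ 2 * VectorCalculus.kineticEnergy (u 0) := by
  obtain ⟨G, -, hE⟩ := hLH.energy_ineq_zero
  have h := hE τ hτ
  simp only [Pi.zero_apply, inner_zero_left, integral_zero, intervalIntegral.integral_zero,
    add_zero] at h
  have hD : 0 ≤ ν * (∫⁻ s in Ioo 0 τ, ∫⁻ x, ENNReal.ofReal (frobeniusNormSq (G s x))).toReal :=
    mul_nonneg hν ENNReal.toReal_nonneg
  have hK : VectorCalculus.kineticEnergy (u τ) ≤ VectorCalculus.kineticEnergy (u 0) := by linarith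
  have hint : Integrable (fun x => ‖u τ x‖ ^ 2) volume :=
    (hLH.memLp τ hτ).integrable_norm_pow two_ne_zero
  have hKE : VectorCalculus.kineticEnergy (u τ) = 2⁻¹ * ∫ x, ‖u τ x‖ ^ 2 := rfl
  linarith [hKE]

/-- **The normalised pressure is bounded on closed slabs**: for `T₁ < T` there is `P` with
`|p̃[u(τ)](x)| ≤ P` on `[0, T₁] × ℝ³` (`abs_normalisedPressure_le` with the slab bounds `‖u‖ ≤ M`,
`‖Du‖ ≤ L` — hence `u(τ)` is `L`-Lipschitz — and `∫‖u(τ)‖² ≤ 2E(u₀)`). [cite: Tao2011, Cor. 11.1] -/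
theorem levelSetModeration_slab_normalisedPressure_bound (hν : 0 < ν)
    (hcl : IsClassicalNSSolutionOn (Ico 0 T) ν 0 u p) (hLH : IsLerayHopfOn T ν 0 (u 0) u)
    (hdec : HasRapidSpatialDecay (u 0)) {T₁ : ℝ} (hT₁ : T₁ ∈ Ioo 0 T) :
    ∃ P : ℝ, ∀ τ ∈ Icc 0 T₁, ∀ x, |normalisedPressure (u τ) x| ≤ P := by
  obtain ⟨M, hM0, hM⟩ := levelSetModeration_slab_velocity_bound hν hcl hLH hdec hT₁
  obtain ⟨L, hL⟩ := levelSetModeration_slice_fderiv_bound hν hcl hLH hdec hT₁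
  have hL0 : 0 ≤ L := by
    have := hL 0 ⟨le_rfl, hT₁.1.le⟩ 0
    exact (norm_nonneg _).trans this
  refine ⟨M ^ 2 / 3 + 8 * M * L + 2 * VectorCalculus.kineticEnergy (u 0) / (2 * Real.pi),
    fun τ hτ x => ?_⟩
  have hτ' : τ ∈ Ico 0 T := ⟨hτ.1, hτ.2.trans_lt hT₁.2⟩
  have hv : ContDiff ℝ 1 (u τ) := (hcl.contDiff_velocity hτ').of_le (by norm_cast)
  have hE : (∫⁻ y, ‖u τ y‖ₑ ^ 2) < ⊤ :=
    lt_of_le_of_lt (hLH.lintegral_enorm_sq_le hν.le ⟨hτ.1, hτ'.2.le⟩) ENNReal.ofReal_lt_top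
  have hM₀ : ∀ y ∈ closedBall x 1, ‖u τ y‖ ≤ M := fun y _ => hM τ hτ y
  have hM₁ : ∀ y ∈ closedBall x 1, ‖u τ y - u τ x‖ ≤ L * ‖y - x‖ := fun y _ =>
    (convex_univ (𝕜 := ℝ) (E := EuclideanSpace ℝ (Fin 3))).norm_image_sub_le_of_norm_fderiv_le
      (fun z _ => (hv.differentiable (by simp)) z) (fun z _ => hL τ hτ z) (mem_univ x) (mem_univ y)
  have h := abs_normalisedPressure_le hv hE hM₀ hM₁ hL0
  have hEn := levelSetModeration_integral_norm_sq_le hν.le hLH ⟨hτ.1, hτ'.2.le⟩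
  have hpi : 0 < 2 * Real.pi := by positivity
  calc |normalisedPressure (u τ) x|
      ≤ M ^ 2 / 3 + 8 * M * L + (∫ y, ‖u τ y‖ ^ 2) / (2 * Real.pi) := h
    _ ≤ M ^ 2 / 3 + 8 * M * L + 2 * VectorCalculus.kineticEnergy (u 0) / (2 * Real.pi) := by
        gcongr

end Slab

/-- **An a.e. bound becomes an everywhere bound for functions continuous within `[0, T)`.** If
`g : ℝ → ℝ` is continuous within `[0, T)` at every point of `[0, T')`, `0 < T' < T`, and `g ≤ B`
for a.e. `τ ∈ [0, T']`, then `g τ ≤ B` for every `τ ∈ [0, T']` (a strict excess at `τ₀` would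
persist on a neighbourhood within `[0, T)`, which meets `[0, T']` in a set of positive measure).
[folklore] -/
theorem levelSetModeration_le_of_ae_le_of_continuousWithinAt {g : ℝ → ℝ} {T T' B : ℝ}
    (hT' : 0 < T') (hT'T : T' < T)
    (hg : ∀ τ ∈ Icc 0 T', ContinuousWithinAt g (Ico 0 T) τ)
    (hae : ∀ᵐ τ ∂(volume.restrict (Icc 0 T')), g τ ≤ B) : ∀ τ ∈ Icc 0 T', g τ ≤ B := by
  intro τ₀ hτ₀
  by_contra hlt
  rw [not_le] at hlt
  -- a neighbourhood within `[0, T)` on which `g > B`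
  have hev : ∀ᶠ τ in 𝓝[Ico 0 T] τ₀, B < g τ :=
    (hg τ₀ hτ₀).eventually (Ioi_mem_nhds hlt)
  obtain ⟨δ, hδ, hball⟩ := Metric.eventually_nhds_iff.1 (eventually_nhdsWithin_iff.1 hev)
  -- the set `S = (τ₀ - δ, τ₀ + δ) ∩ [0, T']` has positive measure and `g > B` on it
  set S : Set ℝ := Ioo (τ₀ - δ) (τ₀ + δ) ∩ Icc 0 T' with hS
  have hSsub : ∀ τ ∈ S, B < g τ := by
    intro τ hτ
    have h1 : dist τ τ₀ < δ := by
      rw [Real.dist_eq, abs_lt]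
      constructor <;> linarith [hτ.1.1, hτ.1.2]
    exact hball h1 ⟨hτ.2.1, hτ.2.2.trans_lt hT'T⟩
  have hSpos : 0 < volume S := by
    -- `S` contains a nondegenerate interval
    have hne : (interior S).Nonempty := by
      rw [hS, interior_inter, interior_Ioo, interior_Icc]
      -- pick a point strictly inside both
      rcases lt_trichotomy τ₀ 0 with h0 | h0 | h0
      · exact absurd hτ₀.1 (not_le.2 h0)
      · refine ⟨min (δ / 2) (T' / 2), ?_, ?_⟩
        · constructor
          · rw [h0]; have : 0 < min (δ / 2) (T' / 2) := by positivity
            linarith [min_le_left (δ / 2) (T' / 2)]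
          · rw [h0]; linarith [min_le_left (δ / 2) (T' / 2)]
        · constructor
          · positivity
          · linarith [min_le_right (δ / 2) (T' / 2)]
      · rcases lt_or_eq_of_le hτ₀.2 with h1 | h1
        · refine ⟨τ₀, ⟨by linarith, by linarith⟩, h0, h1⟩
        · refine ⟨τ₀ - min (δ / 2) (T' / 2), ?_, ?_⟩
          · have : 0 < min (δ / 2) (T' / 2) := by positivity
            constructor
            · linarith [min_le_left (δ / 2) (T' / 2)]
            · linarith
          · have : 0 < min (δ / 2) (T' / 2) := by positivity
            constructor
            · rw [h1]; linarith [min_le_right (δ / 2) (T' / 2)]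
            · linarith
    exact Measure.measure_pos_of_nonempty_interior volume hne
  -- contradiction with the a.e. bound
  have hzero : volume.restrict (Icc 0 T') {τ | ¬ g τ ≤ B} = 0 := ae_iff.1 hae
  have hle : volume S ≤ volume.restrict (Icc 0 T') {τ | ¬ g τ ≤ B} := by
    rw [Measure.restrict_apply' measurableSet_Icc]
    refine measure_mono fun τ hτ => ⟨?_, hτ.2⟩
    exact not_le.2 (hSsub τ hτ)
  rw [hzero] at hle
  exact absurd (hSpos.trans_le hle) (lt_irrefl 0)

section Pressure

variable {ν T : ℝ} {u : ℝ → EuclideanSpace ℝ (Fin 3) → EuclideanSpace ℝ (Fin 3)}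
  {p : ℝ → EuclideanSpace ℝ (Fin 3) → ℝ}

/-- **The given pressure is bounded on closed slabs.** For `ν > 0`, a classical solution `(u, p)` of
the unforced Navier–Stokes system on `ℝ³ × [0, T)` that is Leray–Hopf on `[0, T]` from a rapidly
decaying datum, and `t ∈ [0, T)`: there is `B` with `|p τ x| ≤ B` on `[0, t] × ℝ³`. Proof: on the
closed slab `[0, T']`, `T' = (t+T)/2`, Tao's normalisation gives `p(τ) = p̃[u(τ)] + C(τ)` for a.e. `τ`
with `|C| ≤ M_C`, and `|p̃| ≤ P` there (`levelSetModeration_slab_normalisedPressure_bound`); the a.e.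
bound `|p τ x| ≤ P + M_C` extends to every `τ` by continuity of `τ ↦ p τ x` within `[0, T)`.
[cite: Tao2011, Lemma 4.1 (i) and Cor. 11.1] -/
theorem levelSetModeration_slab_pressure_bound (hν : 0 < ν)
    (hcl : IsClassicalNSSolutionOn (Ico 0 T) ν 0 u p) (hLH : IsLerayHopfOn T ν 0 (u 0) u)
    (hdec : HasRapidSpatialDecay (u 0)) {t : ℝ} (ht : t ∈ Ico 0 T) :
    ∃ B : ℝ, ∀ τ ∈ Icc 0 t, ∀ x, |p τ x| ≤ B := by
  set T' : ℝ := (t + T) / 2 with hT'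
  have hT'pos : 0 < T' := by rw [hT']; linarith [ht.1, ht.2]
  have htT' : t < T' := by rw [hT']; linarith [ht.2]
  have hT'T : T' < T := by rw [hT']; linarith [ht.2]
  have hcl' : IsClassicalNSSolutionOn (Icc 0 T') ν 0 u p :=
    hcl.mono (Icc_subset_Ico_right hT'T) (uniqueDiffOn_Icc hT'pos)
  have hEn : ∃ C : ℝ≥0∞, C < ⊤ ∧ ∀ τ ∈ Icc 0 T', ∫⁻ x, ‖u τ x‖ₑ ^ 2 ≤ C :=
    ⟨ENNReal.ofReal (2 * VectorCalculus.kineticEnergy (u 0)), ENNReal.ofReal_lt_top, fun τ hτ =>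
      hLH.lintegral_enorm_sq_le hν.le ⟨hτ.1, hτ.2.trans hT'T.le⟩⟩
  obtain ⟨C, -, ⟨MC, hMC⟩, hnorm⟩ := tao_pressure_normalisation_holds ν T' hν hT'pos u p hcl' hEn
  obtain ⟨P, hP⟩ := levelSetModeration_slab_normalisedPressure_bound hν hcl hLH hdec ⟨hT'pos, hT'T⟩
  refine ⟨P + MC, fun τ hτ x => ?_⟩
  -- the a.e. bound on `[0, T']`
  have hae : ∀ᵐ τ ∂(volume.restrict (Icc 0 T')), |p τ x| ≤ P + MC := by
    filter_upwards [hnorm, ae_restrict_mem measurableSet_Icc] with τ hτn hτm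
    rw [hτn x]
    calc |normalisedPressure (u τ) x + C τ| ≤ |normalisedPressure (u τ) x| + |C τ| := abs_add_le _ _
      _ ≤ P + MC := add_le_add (hP τ hτm x) (hMC τ hτm)
  -- continuity of `τ ↦ |p τ x|` within `[0, T)`
  have hcont : ∀ τ ∈ Icc 0 T', ContinuousWithinAt (fun τ => |p τ x|) (Ico 0 T) τ := fun τ hτm =>
    (hcl.smooth_pressure.continuousWithinAt_time ⟨hτm.1, hτm.2.trans_lt hT'T⟩ x).abs
  exact levelSetModeration_le_of_ae_le_of_continuousWithinAt hT'pos hT'T hcont hae τ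
    ⟨hτ.1, hτ.2.trans htT'.le⟩

end Pressure

/-- **Uniform slab bounds** (explicit form, registered sub-goal of the crux item): for `ν > 0`, a
classical solution `(u, p)` of the unforced Navier–Stokes system on `ℝ³ × [0, T)` that is Leray–Hopf on
`[0, T]` from a rapidly decaying datum, and `t ∈ [0, T)`, one constant `B` bounds `‖u‖`, `|p|` and
`|p̃[u(τ)]|` on `[0, t] × ℝ³`. [cite: Tao2011, Cor. 11.1 and Lemma 4.1 (i)] -/
theorem levelSetModeration_slabBounds :
    ∀ (ν T : ℝ) (u : ℝ → EuclideanSpace ℝ (Fin 3) → EuclideanSpace ℝ (Fin 3)) (p : ℝ → EuclideanSpace ℝ (Fin 3) → ℝ), 0 < ν → Literature.Analysis.FluidPDE.IsClassicalNSSolutionOn (Set.Ico 0 T) ν 0 u p → Literature.Analysis.FluidPDE.IsLerayHopfOn T ν 0 (u 0) u → Literature.Analysis.FluidPDE.HasRapidSpatialDecay (u 0) → ∀ t ∈ Set.Ico 0 T, ∃ B : ℝ, ∀ τ ∈ Set.Icc 0 t, ∀ x, ‖u τ x‖ ≤ B ∧ |p τ x| ≤ B ∧ |Literature.Analysis.FluidPDE.normalisedPressure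 (u τ) x| ≤ B := by
  intro ν T u p hν hcl hLH hdec t ht
  have hT₁ : (t + T) / 2 ∈ Set.Ioo 0 T := ⟨by linarith [ht.1, ht.2], by linarith [ht.2]⟩
  have htT₁ : t ≤ (t + T) / 2 := by linarith [ht.2]
  obtain ⟨M, -, hM⟩ := levelSetModeration_slab_velocity_bound hν hcl hLH hdec hT₁
  obtain ⟨P, hP⟩ := levelSetModeration_slab_normalisedPressure_bound hν hcl hLH hdec hT₁
  obtain ⟨B, hB⟩ := levelSetModeration_slab_pressure_bound hν hcl hLH hdec ht
  refine ⟨max M (max P B), fun τ hτ x => ⟨?_, ?_, ?_⟩⟩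
  · exact (hM τ ⟨hτ.1, hτ.2.trans htT₁⟩ x).trans (le_max_left _ _)
  · exact (hB τ hτ x).trans ((le_max_right _ _).trans (le_max_right _ _))
  · exact (hP τ ⟨hτ.1, hτ.2.trans htT₁⟩ x).trans ((le_max_left _ _).trans (le_max_right _ _))

end Summit.NavierStokesRegularity.NavierStokesRegularity.Theorems
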